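import Literature.AlgebraicGeometry.PlaneCurves.AffineNodalCurves
import Literature.Algebra.Polynomial.LaplacianOrthogonalInvariance
import HarnessLib

/-!
# Nodal affine plane curves, II: pull-back along a polynomial map at an étale point

Topic `Literature/AlgebraicGeometry/PlaneCurves`, namespace `Literature.AlgebraicGeometry.PlaneCurves.AffineNodalCurves` (sequel of
`AffineNodalCurves`). Everything here is PROVED over an arbitrary field; no named fact, nothing conditional. Written by the prover
seat `leafhand-hodge-q8symplecticpowers-4` (g5, cell `pub-hsemireg`) for lemma Zb-4 «nodal genericity» of the S1 programme of
route `HodgeConjecture/Q8SymplecticPowers` (crux K1Q, stmt-HodgeConjecture-24190): the component `Ψ̃ = φ*Ψ` of the branch curve of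
the route's double plane is the pull-back of a plane curve `ψ = 0` along the polynomial chart map `Φ(s, y) = lin(s²y, y)` of
`𝔽₂ → ℙ²`, which is étale where its Jacobian `2sy · det(lin)` is non-zero; smoothness, transversality and nodality of the pulled
back configuration there are read off downstairs by the lemmas below. Honest scope: the chain rule, twice; nothing here bears on
HC, and S1 ∕ K1Q are NOT proved here.

Source. W. Fulton, *Algebraic Curves* (2008 ed.), §3.1 (multiplicity, tangent lines and ordinary multiple points are defined through
the lowest form of the local equation; they are preserved by a change of coordinates whose linear part is invertible — the book's
standing reduction «we may assume `P = (0,0)`» by an affine change of coordinates, here extended to any polynomial map with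
invertible differential at the point, whose effect on the forms of degree `≤ 2` at the point is that of its linear part once the
gradient vanishes). The first-order chain rule `∂ⱼ(P ∘ L) = Σᵢ ∂ⱼLᵢ · (∂ᵢP) ∘ L` is the tree's
`Literature.Algebra.Polynomial.pderiv_bind₁`.

## Dictionary

* `mapPt Φ p = Φ(p)` for a polynomial self-map `Φ : Fin 2 → k[x,y]` of the plane; `mapJac Φ p = det DΦ(p)`.
* `bind₁ Φ f = f ∘ Φ` (Mathlib), the pulled-back curve equation.

## What is here

* `eval_bind₁_eq` (`(f ∘ Φ)(p) = f(Φ(p))`), `grad_bind₁_apply` (`∇(f∘Φ)(p) = DΦ(p)ᵀ ∇f(Φ(p))`),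
  `jac_bind₁` (`∇(f∘Φ) × ∇(g∘Φ) = det DΦ · (∇f × ∇g) ∘ Φ`: transversality pulls back at étale points),
  `grad_bind₁_eq_zero_iff` ∕ `isSingularPoint_bind₁_iff` (at an étale point, `p` is singular on `f∘Φ = 0` iff `Φ(p)` is singular on
  `f = 0`), `hess_bind₁_of_grad_eq_zero` and `hessDet_bind₁_of_isSingularPoint` (second-order chain rule at a critical point:
  `Hess(f∘Φ)(p) = DΦᵀ · Hess f(Φ(p)) · DΦ`, so `hessDet (f∘Φ) p = (det DΦ)² · hessDet f (Φ p)`), and the conclusions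
  **`isNodalAt_bind₁`** (nodality pulls back at étale points) and `isOrdinaryDoublePoint_bind₁_iff`.

## References
* [Fulton2008] W. Fulton, *Algebraic Curves* (2008), §3.1 (multiple points, tangent lines, ordinary multiple points; invariance
  under change of coordinates).
* [AxlerBourdonRamey2001] (via the tree's `pderiv_bind₁`) chain rule for polynomial substitution.
-/

set_option autoImplicit false

open MvPolynomial

namespace Literature.AlgebraicGeometry.PlaneCurves.AffineNodalCurves

open Literature.AlgebraicGeometry.PlaneCurves.SingularPointsEnvelopes Literature.Algebra.Polynomial

variable {k : Type*} [Field k]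

/-- The value `Φ(p)` of a polynomial self-map `Φ = (Φ₀, Φ₁)` of the affine plane at `p`.
[cite: Fulton2008, §3.1 (affine change of coordinates)] -/
noncomputable def mapPt (Φ : Fin 2 → MvPolynomial (Fin 2) k) (p : Fin 2 → k) : Fin 2 → k :=
  fun j => MvPolynomial.eval p (Φ j)

/-- The Jacobian determinant `det DΦ(p) = ∂ₓΦ₀ ∂ᵧΦ₁ − ∂ᵧΦ₀ ∂ₓΦ₁` of `Φ` at `p` (`Φ` is étale at `p` iff it is non-zero).
[cite: Fulton2008, §3.1 (change of coordinates with invertible linear part)] -/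
noncomputable def mapJac (Φ : Fin 2 → MvPolynomial (Fin 2) k) (p : Fin 2 → k) : k :=
  grad (Φ 0) p 0 * grad (Φ 1) p 1 - grad (Φ 0) p 1 * grad (Φ 1) p 0

variable {Φ : Fin 2 → MvPolynomial (Fin 2) k} {f g : MvPolynomial (Fin 2) k} {p : Fin 2 → k}

/-- Components of `mapPt`. [cite: Fulton2008, §3.1 (affine change of coordinates)] -/
theorem mapPt_apply (Φ : Fin 2 → MvPolynomial (Fin 2) k) (p : Fin 2 → k) (j : Fin 2) :
    mapPt Φ p j = MvPolynomial.eval p (Φ j) := rfl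

/-- `(f ∘ Φ)(p) = f(Φ(p))`. [cite: Fulton2008, §3.1 (affine change of coordinates)] -/
theorem eval_bind₁_eq (Φ : Fin 2 → MvPolynomial (Fin 2) k) (f : MvPolynomial (Fin 2) k) (p : Fin 2 → k) :
    MvPolynomial.eval p (bind₁ Φ f) = MvPolynomial.eval (mapPt Φ p) f :=
  eval₂Hom_bind₁ _ _ _ _

/-- **Chain rule at a point**: `∂ᵢ(f ∘ Φ)(p) = Σⱼ ∂ᵢΦⱼ(p) · (∂ⱼf)(Φ(p))`, i.e. `∇(f∘Φ)(p) = DΦ(p)ᵀ ∇f(Φ(p))`.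
[cite: Fulton2008, §3.1 (change of coordinates)] -/
theorem grad_bind₁_apply (Φ : Fin 2 → MvPolynomial (Fin 2) k) (f : MvPolynomial (Fin 2) k) (p : Fin 2 → k) (i : Fin 2) :
    grad (bind₁ Φ f) p i = ∑ j, grad (Φ j) p i * grad f (mapPt Φ p) j := by
  simp only [grad_apply, pderiv_bind₁, map_sum, map_mul, eval_bind₁_eq]

/-- **Transversality pulls back at étale points**: `∇(f∘Φ)(p) × ∇(g∘Φ)(p) = det DΦ(p) · (∇f × ∇g)(Φ(p))`.
[cite: Fulton2008, §3.1 (tangent lines under change of coordinates)] -/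
theorem jac_bind₁ (Φ : Fin 2 → MvPolynomial (Fin 2) k) (f g : MvPolynomial (Fin 2) k) (p : Fin 2 → k) :
    jac (bind₁ Φ f) (bind₁ Φ g) p = mapJac Φ p * jac f g (mapPt Φ p) := by
  simp only [jac, grad_bind₁_apply, Fin.sum_univ_two, mapJac]
  ring

/-- If `∇f(Φ(p)) = 0` then `∇(f∘Φ)(p) = 0`. [cite: Fulton2008, §3.1 (change of coordinates)] -/
theorem grad_bind₁_eq_zero_of_grad_eq_zero (h : grad f (mapPt Φ p) = 0) : grad (bind₁ Φ f) p = 0 := by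
  funext i
  rw [grad_bind₁_apply]
  simp [h]

/-- At an étale point (`det DΦ(p) ≠ 0`), `∇(f∘Φ)(p) = 0 ↔ ∇f(Φ(p)) = 0`. [cite: Fulton2008, §3.1 (change of coordinates with
invertible linear part)] -/
theorem grad_bind₁_eq_zero_iff (hJ : mapJac Φ p ≠ 0) : grad (bind₁ Φ f) p = 0 ↔ grad f (mapPt Φ p) = 0 := by
  refine ⟨fun h => ?_, grad_bind₁_eq_zero_of_grad_eq_zero⟩
  have h0 := congrFun h 0
  have h1 := congrFun h 1
  simp only [grad_bind₁_apply, Fin.sum_univ_two, Pi.zero_apply] at h0 h1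
  -- Cramer: `det DΦ · v = 0`
  set a := grad (Φ 0) p 0
  set b := grad (Φ 0) p 1
  set c := grad (Φ 1) p 0
  set d := grad (Φ 1) p 1
  set v₀ := grad f (mapPt Φ p) 0
  set v₁ := grad f (mapPt Φ p) 1
  have hJ' : a * d - b * c ≠ 0 := hJ
  have e₀ : (a * d - b * c) * v₀ = d * (a * v₀ + c * v₁) - c * (b * v₀ + d * v₁) := by ring
  have e₁ : (a * d - b * c) * v₁ = a * (b * v₀ + d * v₁) - b * (a * v₀ + c * v₁) := by ring
  rw [h0, h1, mul_zero, mul_zero, sub_zero] at e₀ e₁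
  have hv₀ : v₀ = 0 := (mul_eq_zero.1 e₀).resolve_left hJ'
  have hv₁ : v₁ = 0 := (mul_eq_zero.1 e₁).resolve_left hJ'
  funext j
  fin_cases j
  · exact hv₀
  · exact hv₁

/-- At an étale point, `p` is a singular point of `f ∘ Φ = 0` iff `Φ(p)` is a singular point of `f = 0`.
[cite: Fulton2008, §3.1 (multiplicity is invariant under change of coordinates)] -/
theorem isSingularPoint_bind₁_iff (hJ : mapJac Φ p ≠ 0) :
    IsSingularPoint (bind₁ Φ f) p ↔ IsSingularPoint f (mapPt Φ p) := by
  simp only [IsSingularPoint, eval_bind₁_eq, grad_bind₁_eq_zero_iff hJ]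

/-- **Second-order chain rule at a critical point**: if `∇f(Φ(p)) = 0` then
`∂ᵢ∂ᵢ′(f∘Φ)(p) = Σⱼ Σₗ ∂ᵢ′Φⱼ(p) ∂ᵢΦₗ(p) (∂ₗ∂ⱼ f)(Φ(p))`, i.e. `Hess(f∘Φ)(p) = DΦ(p)ᵀ · Hess f(Φ(p)) · DΦ(p)`.
[cite: Fulton2008, §3.1 (the lowest form under change of coordinates)] -/
theorem hess_bind₁_of_grad_eq_zero (h : grad f (mapPt Φ p) = 0) (i i' : Fin 2) :
    hess (bind₁ Φ f) p i i' = ∑ j, ∑ l, grad (Φ j) p i' * grad (Φ l) p i * hess f (mapPt Φ p) l j := by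
  have hj : ∀ j, MvPolynomial.eval (mapPt Φ p) (pderiv j f) = 0 := fun j => by
    have := congrFun h j; rwa [grad_apply] at this
  simp only [hess, pderiv_bind₁, map_sum, pderiv_mul, map_add, map_mul, eval_bind₁_eq, hj, mul_zero, zero_add,
    grad_apply, Finset.mul_sum]
  refine Finset.sum_congr rfl fun j _ => Finset.sum_congr rfl fun l _ => ?_
  ring

/-- At a singular point `Φ(p)` of `f = 0`: `hessDet (f∘Φ) p = (det DΦ(p))² · hessDet f (Φ(p))`.
[cite: Fulton2008, §3.1 (ordinary multiple points are preserved by change of coordinates)] -/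
theorem hessDet_bind₁_of_isSingularPoint (h : IsSingularPoint f (mapPt Φ p)) :
    hessDet (bind₁ Φ f) p = mapJac Φ p ^ 2 * hessDet f (mapPt Φ p) := by
  simp only [hessDet, hess_bind₁_of_grad_eq_zero h.2, Fin.sum_univ_two, mapJac]
  ring

/-- **Nodality pulls back at étale points**: if `det DΦ(p) ≠ 0` and `f = 0` is nodal at `Φ(p)`, then `f ∘ Φ = 0` is nodal at `p`.
[cite: Fulton2008, §3.1 (nodes; invariance under change of coordinates)] -/
theorem isNodalAt_bind₁ (hJ : mapJac Φ p ≠ 0) (h : IsNodalAt f (mapPt Φ p)) : IsNodalAt (bind₁ Φ f) p := by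
  intro hs
  have hs' : IsSingularPoint f (mapPt Φ p) := (isSingularPoint_bind₁_iff hJ).1 hs
  rw [hessDet_bind₁_of_isSingularPoint hs']
  exact mul_ne_zero (pow_ne_zero 2 hJ) (h hs')

/-- At an étale point, `p` is an ordinary double point of `f ∘ Φ = 0` iff `Φ(p)` is one of `f = 0`.
[cite: Fulton2008, §3.1 (ordinary multiple points; invariance under change of coordinates)] -/
theorem isOrdinaryDoublePoint_bind₁_iff (hJ : mapJac Φ p ≠ 0) :
    IsOrdinaryDoublePoint (bind₁ Φ f) p ↔ IsOrdinaryDoublePoint f (mapPt Φ p) := by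
  constructor
  · rintro ⟨hs, hd⟩
    have hs' := (isSingularPoint_bind₁_iff hJ).1 hs
    refine ⟨hs', fun h0 => hd ?_⟩
    rw [hessDet_bind₁_of_isSingularPoint hs', h0, mul_zero]
  · rintro ⟨hs', hd⟩
    refine ⟨(isSingularPoint_bind₁_iff hJ).2 hs', ?_⟩
    rw [hessDet_bind₁_of_isSingularPoint hs']
    exact mul_ne_zero (pow_ne_zero 2 hJ) hd

/-- If `Φ` is étale at every point of the curve `f ∘ Φ = 0` and `f = 0` is nodal, then `f ∘ Φ = 0` is nodal.
[cite: Fulton2008, §3.1 (nodes; invariance under change of coordinates)] -/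
theorem IsNodal.bind₁ (hf : IsNodal f) (hJ : ∀ p, MvPolynomial.eval p (bind₁ Φ f) = 0 → mapJac Φ p ≠ 0) :
    IsNodal (bind₁ Φ f) :=
  fun p hs => isNodalAt_bind₁ (hJ p hs.1) (hf (mapPt Φ p)) hs

end Literature.AlgebraicGeometry.PlaneCurves.AffineNodalCurves
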